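import Mathlib
import Summits.SmoothPoincare4.SmoothPoincare4.Theorems.CylinderEntropyCylinderRungTwoKCertSoundLeaf
import HarnessLib

/-!
# Kernel certificate checker for `stub_certMid`, IX-b: soundness of the leaf test and of the bisection

Infrastructure file for the kernel-clean discharge of the registered stub `stub_certMid` of crux stmt-SmoothPoincare4-7631
(`Summit.SmoothPoincare4.SmoothPoincare4.Theses.CylinderEntropy.CylinderRungTwo`, line `killing-flux`).  A valid box that
passes `leafOKF` satisfies `E_T ≤ R` at every point and every `T ∈ [T₁, T₂]` (zeroth-order test directly; corner test by
reduction of `T` to the envelope range, the derivative enclosures and the mean value theorem from the nearest corner);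
`runF` is sound by induction on the fuel; the root sub-boxes have valid data.  No named facts.
-/

-- the registered namespace `Summit.SmoothPoincare4.SmoothPoincare4.…` repeats a component
set_option linter.dupNamespace false

noncomputable section

namespace Summit.SmoothPoincare4.SmoothPoincare4.Cruxes.CylinderRungTwo.KillingFlux

namespace KCert


open Set
open Literature.Analysis.ValidatedNumerics.NumericsMP
open Summit.SmoothPoincare4.SmoothPoincare4.Theorems.CylinderEntropySliceIsolation
open Summit.SmoothPoincare4.SmoothPoincare4.Theorems.CylinderEntropySliceIsolation.Cert

variable (C : KCell)

/-! ### The leaf test -/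

/-- **Soundness of the leaf test.** [folklore] -/
theorem leafOK_sound (hT1 : 0 < C.T1) (hT12 : C.T1 ≤ C.T2) (hat : atomsOK C C.atoms = true) (hg : gridOK C = true)
    {tabs : List (List TabE)} (htabs : List.Forall₂ (TabOK C) C.atoms tabs) {B : BoxD} (hB : BoxOK C tabs B)
    (hleaf : leafOKF C tabs B = true) : BoxClaim C B := by
  intro u θ hp T hTlo hThi
  have hS := S64_cast_pos.2
  have hSp := S64_pos
  have hA := atomsOK_forall C hat
  have hB' := hB
  obtain ⟨hU1, hU2, hTD1, hTD2, _⟩ := hB'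
  obtain ⟨_, _, _, _, _, _, _, hθ0, hθ1', hθ2', hth1⟩ := point_data C hB hp
  obtain ⟨hu1, hu2, hθ1, hθ2, hθπ⟩ := hp
  have hπ1 : (B.T1.t : ℝ) ≤ Real.pi := hθ1.trans hθπ
  have ht1 : 0 ≤ B.T1.t := hTD1.1
  have ht2 : 0 ≤ B.T2.t := hTD2.1
  have hT2th := TD.th_mem ht2
  -- the atom enclosures at any point of the box
  have hAt : ∀ {v x : ℝ}, (B.U1.u : ℝ) ≤ v → v ≤ (B.U2.u : ℝ) → B.T1.th ≤ x → x ≤ B.T2.th →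
      let r := atomsBox B C.atoms tabs B.U1.glo B.U2.glo B.U1.ghi B.U2.ghi B.T1.tfl B.T2.tfl B.T1.hup
      ((r.1 : ℤ) : ℝ) ≤ (C.atoms.map fun a => (a.w : ℝ) * a.G v * a.Zc x).sum * S64 ∧
        MI.mem S64 (C.dRu v x) r.2.1 ∧ MI.mem S64 (C.dRt v x) r.2.2 := by
    intro v x hv1 hv2 hx1 hx2
    obtain ⟨_, hg1, hh1⟩ := hU1
    obtain ⟨_, hg2, hh2⟩ := hU2
    obtain ⟨ht1, _, _, _, hia1, hib1, hθa1, hθb1, hf1, hhp1⟩ := hTD1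
    obtain ⟨ht2, _, _, _, hia2, hib2, _, hθb2, hf2, _⟩ := hTD2
    exact atomsBox_spec C hg B ht1 ht2 hia1 hib1 hia2 hib2 hθa1 hθb1 hθb2 hπ1 hv1 hv2 hx1 hx2 C.atoms tabs
      _ _ _ _ _ _ _ hA htabs hg1 hg2 hh1 hh2 hf1 hf2 hhp1
  -- points of the box in angle coordinates are points of the box
  have hInBox : ∀ {v x : ℝ}, (B.U1.u : ℝ) ≤ v → v ≤ (B.U2.u : ℝ) → B.T1.th ≤ x → x ≤ B.T2.th → InBox B v x :=
    fun hv1 hv2 hx1 hx2 => ⟨hv1, hv2, hth1 ▸ hx1, hx2.trans (min_le_left _ _), hx2.trans (min_le_right _ _)⟩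
  obtain ⟨hEhi, _, hred⟩ := leafE_spec C hT1 hT12 hB ⟨hu1, hu2, hθ1, hθ2, hθπ⟩
  have hRdef : ∀ v x, C.R v x = (C.c : ℝ) + (C.atoms.map fun a => (a.w : ℝ) * a.G v * a.Zc x).sum := fun v x => rfl
  unfold leafOKF at hleaf
  simp only [Bool.or_eq_true, decide_eq_true_eq] at hleaf
  rcases hleaf with h0 | h1
  · -- zeroth-order test
    have hv := (hAt hu1 hu2 hθ1' hθ2').1
    have hE := hEhi T hTlo hThi
    have h0R : ((zhi64 (leafE C B).1 : ℤ) : ℝ) ≤ ((zlo64 C.c : ℤ) : ℝ) +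
        ((atomsBox B C.atoms tabs B.U1.glo B.U2.glo B.U1.ghi B.U2.ghi B.T1.tfl B.T2.tfl B.T1.hup).1 : ℝ) := by
      exact_mod_cast h0
    have hc := zlo64_le C.c
    have hz := le_zhi64 (leafE C B).1
    rw [hRdef]
    nlinarith
  · -- corner test, after reduction of `T` to the envelope range
    obtain ⟨T', hTa', hTb', hT1', hT2', hEE⟩ := hred T hTlo hThi
    refine hEE.trans ?_
    simp only [test1F, Bool.and_eq_true, decide_eq_true_eq] at h1
    obtain ⟨⟨⟨hhu0, hht0⟩, hTa0⟩, hmain⟩ := h1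
    set A := atomsBox B C.atoms tabs B.U1.glo B.U2.glo B.U1.ghi B.U2.ghi B.T1.tfl B.T2.tfl B.T1.hup with hAdef
    set E := leafE C B with hEdef
    set Gu := (A.2.1.sub (dEuBox B E)).absHi with hGu
    set Gt := (A.2.2.sub (dEtBoxF C B E)).absHi with hGt
    set hu := zhi64 ((B.U2.u - B.U1.u) / 2) with hhu
    set ht := zhi64 ((B.T2.t - B.T1.t) / 2) with hht
    have hT'0 : 0 < T' := (show (0 : ℝ) < C.T1 by exact_mod_cast hT1).trans_le hT1'
    -- `φ = R - E_{T'}`; derivative bounds on the box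
    set φ : ℝ → ℝ → ℝ := fun v x => C.R v x - Ek T' v x with hφ
    have hGuB : ∀ {v x : ℝ}, (B.U1.u : ℝ) ≤ v → v ≤ (B.U2.u : ℝ) → B.T1.th ≤ x → x ≤ B.T2.th →
        |C.dRu v x - Ek T' v x * (4 - Real.exp v * (Real.exp v - Real.cos x) / (2 * T'))| ≤ (Gu : ℝ) / S64 ∧
        |C.dRt v x - -(Ek T' v x * Real.exp v * Real.sin x / (2 * T'))| ≤ (Gt : ℝ) / S64 := by
      intro v x hv1 hv2 hx1 hx2
      have hpx := hInBox hv1 hv2 hx1 hx2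
      obtain ⟨_, hmu, hmt⟩ := hAt hv1 hv2 hx1 hx2
      obtain ⟨hEhi', hElo', _⟩ := leafE_spec C hT1 hT12 hB hpx
      obtain ⟨hdu, hdt⟩ := dEBox_spec C hB hpx (E := E) hTa0 hTa' hTb' (hElo' T' hTa' hTb') (hEhi' T' hT1' hT2')
      constructor
      · rw [le_div_iff₀ hS]; exact MI.abs_le_absHi (MI.mem_sub hmu hdu)
      · rw [le_div_iff₀ hS]; exact MI.abs_le_absHi (MI.mem_sub hmt hdt)
    -- MVT in `θ` at fixed `u`, then in `u` at the corner angle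
    have hx_mvt : ∀ xc ∈ Icc B.T1.th B.T2.th, φ u xc - (Gt : ℝ) / S64 * |θ - xc| ≤ φ u θ := by
      intro xc hxc
      refine mvt_lower (φ := fun x => φ u x)
        (φ' := fun x => C.dRt u x - -(Ek T' u x * Real.exp u * Real.sin x / (2 * T')))
        (fun x hx => ((hasDerivAt_R_t C hat u x).sub (hasDerivAt_Ek_θ hT'0.ne' u x)))
        (fun x hx => (hGuB hu1 hu2 hx.1 hx.2).2) ⟨hθ1', hθ2'⟩ hxc
    have hu_mvt : ∀ xc ∈ Icc B.T1.th B.T2.th, ∀ uc ∈ Icc (B.U1.u : ℝ) (B.U2.u : ℝ),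
        φ uc xc - (Gu : ℝ) / S64 * |u - uc| ≤ φ u xc := by
      intro xc hxc uc huc
      refine mvt_lower (φ := fun v => φ v xc)
        (φ' := fun v => C.dRu v xc - Ek T' v xc * (4 - Real.exp v * (Real.exp v - Real.cos xc) / (2 * T')))
        (fun v hv => ((hasDerivAt_R_u C hat xc v).sub (hasDerivAt_Ek_u hT'0.ne' v xc)))
        (fun v hv => (hGuB hv.1 hv.2 hxc.1 hxc.2).1) ⟨hu1, hu2⟩ huc
    -- the nearest corner
    obtain ⟨uc, huc, hucd, hucE⟩ : ∃ uc ∈ Icc (B.U1.u : ℝ) (B.U2.u : ℝ), |u - uc| * S64 ≤ (hu : ℝ) ∧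
        (uc = B.U1.u ∨ uc = B.U2.u) := by
      have hhuR : ((B.U2.u : ℝ) - B.U1.u) / 2 * S64 ≤ (hu : ℝ) := by
        have := le_zhi64 ((B.U2.u - B.U1.u) / 2); push_cast at this; exact this
      rcases le_total (u - B.U1.u) ((B.U2.u : ℝ) - u) with hc | hc
      · refine ⟨B.U1.u, ⟨le_rfl, hu1.trans hu2⟩, le_trans ?_ hhuR, Or.inl rfl⟩
        rw [abs_of_nonneg (by linarith)]
        exact mul_le_mul_of_nonneg_right (by linarith) hS.le
      · refine ⟨B.U2.u, ⟨hu1.trans hu2, le_rfl⟩, le_trans ?_ hhuR, Or.inr rfl⟩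
        rw [abs_of_nonpos (by linarith)]
        exact mul_le_mul_of_nonneg_right (by linarith) hS.le
    obtain ⟨xc, hxc, hxcd, hxcE⟩ : ∃ xc ∈ Icc B.T1.th B.T2.th, |θ - xc| * S64 ≤ (ht : ℝ) ∧
        (xc = B.T1.th ∨ xc = B.T2.th) := by
      have hhtR : ((B.T2.t : ℝ) - B.T1.t) / 2 * S64 ≤ (ht : ℝ) := by
        have := le_zhi64 ((B.T2.t - B.T1.t) / 2); push_cast at this; exact this
      have hw : B.T2.th - B.T1.th ≤ (B.T2.t : ℝ) - B.T1.t := by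
        rw [hth1]; have := min_le_left (B.T2.t : ℝ) Real.pi; unfold TD.th; linarith
      rcases le_total (θ - B.T1.th) (B.T2.th - θ) with hc | hc
      · refine ⟨B.T1.th, ⟨le_rfl, hθ1'.trans hθ2'⟩, le_trans ?_ hhtR, Or.inl rfl⟩
        rw [abs_of_nonneg (by linarith)]
        exact mul_le_mul_of_nonneg_right (by linarith) hS.le
      · refine ⟨B.T2.th, ⟨hθ1'.trans hθ2', le_rfl⟩, le_trans ?_ hhtR, Or.inr rfl⟩
        rw [abs_of_nonpos (by linarith)]
        exact mul_le_mul_of_nonneg_right (by linarith) hS.le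
    -- the corner margin
    have hcorner : ((dminBox C B : ℤ) : ℝ) ≤ φ uc xc * S64 := by
      obtain ⟨d11, d12, d21, d22⟩ := dminBox_spec C hat hB hT1' hT2'
      rcases hucE with rfl | rfl <;> rcases hxcE with rfl | rfl
      · exact d11
      · exact d12
      · exact d21
      · exact d22
    -- assemble
    have hGu0 : (0 : ℝ) ≤ Gu := by
      have : (0 : ℤ) ≤ Gu := by rw [hGu]; unfold MI.absHi; exact le_max_of_le_left (abs_nonneg _)
      exact_mod_cast this
    have hGt0 : (0 : ℝ) ≤ Gt := by
      have : (0 : ℤ) ≤ Gt := by rw [hGt]; unfold MI.absHi; exact le_max_of_le_left (abs_nonneg _)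
      exact_mod_cast this
    have hSz : (0 : ℤ) < (S64 : ℤ) := by exact_mod_cast hSp
    have hm1 := le_cdivZ_real (hu * Gu) hSz
    have hm2 := le_cdivZ_real (ht * Gt) hSz
    have hmainR : ((cdivZ (hu * Gu) S64 : ℤ) : ℝ) + ((cdivZ (ht * Gt) S64 : ℤ) : ℝ) ≤ ((dminBox C B : ℤ) : ℝ) := by
      exact_mod_cast hmain
    have h1' := hx_mvt xc hxc
    have h2' := hu_mvt xc hxc uc huc
    -- `S φ(u,θ) ≥ S φ(uc,xc) - Gu |u-uc| - Gt |θ-xc| ≥ dmin - hu Gu/S - ht Gt/S ≥ 0`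
    have f1 : (Gu : ℝ) * |u - uc| ≤ (hu : ℝ) * Gu / S64 := by
      rw [le_div_iff₀ hS]; nlinarith only [mul_le_mul_of_nonneg_left hucd hGu0]
    have f2 : (Gt : ℝ) * |θ - xc| ≤ (ht : ℝ) * Gt / S64 := by
      rw [le_div_iff₀ hS]; nlinarith only [mul_le_mul_of_nonneg_left hxcd hGt0]
    have f3 : (hu : ℝ) * Gu / S64 + (ht : ℝ) * Gt / S64 ≤ ((dminBox C B : ℤ) : ℝ) := by
      push_cast at hm1 hm2 hmainR
      linarith only [hm1, hm2, hmainR]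
    have g1 : φ u xc * S64 - (Gt : ℝ) * |θ - xc| ≤ φ u θ * S64 := by
      have h := mul_le_mul_of_nonneg_right h1' hS.le
      have e : (φ u xc - (Gt : ℝ) / S64 * |θ - xc|) * S64 = φ u xc * S64 - (Gt : ℝ) * |θ - xc| := by
        field_simp
      linarith only [h, e]
    have g2 : φ uc xc * S64 - (Gu : ℝ) * |u - uc| ≤ φ u xc * S64 := by
      have h := mul_le_mul_of_nonneg_right h2' hS.le
      have e : (φ uc xc - (Gu : ℝ) / S64 * |u - uc|) * S64 = φ uc xc * S64 - (Gu : ℝ) * |u - uc| := by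
        field_simp
      linarith only [h, e]
    have hkey : 0 ≤ φ u θ * S64 := by linarith only [f1, f2, f3, g1, g2, hcorner]
    have hφu : φ u θ = C.R u θ - Ek T' u θ := rfl
    rw [hφu] at hkey
    nlinarith only [hkey, hS]

/-! ### The bisection -/

/-- Splitting in `u` preserves the box invariant. [folklore] -/
theorem BoxOK_splitU (hT1 : 0 < C.T1) (hat : atomsOK C C.atoms = true) {tabs : List (List TabE)} {B : BoxD}
    (hB : BoxOK C tabs B) (um : ℚ) :
    BoxOK C tabs ⟨B.U1, mkUD C um, B.T1, B.T2, B.e11, B.e12, eCorner C (mkUD C um) B.T1, eCorner C (mkUD C um) B.T2⟩ ∧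
    BoxOK C tabs ⟨mkUD C um, B.U2, B.T1, B.T2, eCorner C (mkUD C um) B.T1, eCorner C (mkUD C um) B.T2, B.e21, B.e22⟩ := by
  obtain ⟨hU1, hU2, hT1', hT2', he11, he12, he21, he22, _⟩ := hB
  have hUm := mkUD_ok C hat um
  have hc1 : CornerOK C (mkUD C um) B.T1 (eCorner C (mkUD C um) B.T1) := fun T h1 h2 => eCorner_spec C hT1 hUm hT1' h1 h2
  have hc2 : CornerOK C (mkUD C um) B.T2 (eCorner C (mkUD C um) B.T2) := fun T h1 h2 => eCorner_spec C hT1 hUm hT2' h1 h2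
  exact ⟨⟨hU1, hUm, hT1', hT2', he11, he12, hc1, hc2, rfl⟩, ⟨hUm, hU2, hT1', hT2', hc1, hc2, he21, he22, rfl⟩⟩

/-- Splitting in `θ` preserves the box invariant (hinted index ranges are below `N`). [folklore] -/
theorem BoxOK_splitT (hT1 : 0 < C.T1) (hat : atomsOK C C.atoms = true) (hg : gridOK C = true)
    {tabs : List (List TabE)} (htabs : List.Forall₂ (TabOK C) C.atoms tabs) {B : BoxD} (hB : BoxOK C tabs B)
    {tm : ℚ} (htm : 0 ≤ tm) :
    let Tm := mkTDh C tabs tm B.T1.ia B.T2.ia B.T1.ib B.T2.ib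
    BoxOK C tabs ⟨B.U1, B.U2, B.T1, Tm, B.e11, eCorner C B.U1 Tm, B.e21, eCorner C B.U2 Tm⟩ ∧
    BoxOK C tabs ⟨B.U1, B.U2, Tm, B.T2, eCorner C B.U1 Tm, B.e12, eCorner C B.U2 Tm, B.e22⟩ := by
  intro Tm
  obtain ⟨hU1, hU2, hT1', hT2', he11, he12, he21, he22, _⟩ := hB
  have hTm : TDok C Tm := mkTDh_ok C hat hg htabs htm hT2'.2.2.2.2.1 hT2'.2.2.2.2.2.1
  have hc1 : CornerOK C B.U1 Tm (eCorner C B.U1 Tm) := fun T h1 h2 => eCorner_spec C hT1 hU1 hTm h1 h2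
  have hc2 : CornerOK C B.U2 Tm (eCorner C B.U2 Tm) := fun T h1 h2 => eCorner_spec C hT1 hU2 hTm h1 h2
  exact ⟨⟨hU1, hU2, hT1', hTm, he11, hc1, he21, hc2, rfl⟩, ⟨hU1, hU2, hTm, hT2', hc1, he12, hc2, he22, rfl⟩⟩

/-- **Soundness of the script replay**: a successful `runF` on a valid box certifies the box. [folklore] -/
theorem run_sound (hT1 : 0 < C.T1) (hT12 : C.T1 ≤ C.T2) (hat : atomsOK C C.atoms = true) (hg : gridOK C = true)
    {tabs : List (List TabE)} (htabs : List.Forall₂ (TabOK C) C.atoms tabs) :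
    ∀ (fuel code : ℕ) (B : BoxD) (c' : ℕ), BoxOK C tabs B → runF C tabs fuel code B = some c' → BoxClaim C B := by
  intro fuel
  induction fuel with
  | zero => intro code B c' _ h; simp [runF] at h
  | succ fuel ih =>
    intro code B c' hB h
    rw [runF] at h
    split at h
    · -- leaf
      split_ifs at h with hleaf
      exact leafOK_sound C hT1 hT12 hat hg htabs hB hleaf
    · -- split in `u`
      dsimp only at h
      split at h
      · rename_i code1 h1
        obtain ⟨hL, hR⟩ := BoxOK_splitU C hT1 hat hB ((B.U1.u + B.U2.u) / 2)
        have cL := ih _ _ _ hL h1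
        have cR := ih _ _ _ hR h
        intro u θ hp T hTa hTb
        obtain ⟨hu1, hu2, hθ1, hθ2, hθπ⟩ := hp
        rcases le_total u ((((B.U1.u + B.U2.u) / 2 : ℚ)) : ℝ) with hc | hc
        · exact cL u θ ⟨hu1, hc, hθ1, hθ2, hθπ⟩ T hTa hTb
        · exact cR u θ ⟨hc, hu2, hθ1, hθ2, hθπ⟩ T hTa hTb
      · simp at h
    · -- split in `θ`
      dsimp only at h
      split at h
      · rename_i code1 h1
        have htm : 0 ≤ (B.T1.t + B.T2.t) / 2 := by
          have := hB.2.2.1.1; have := hB.2.2.2.1.1; linarith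
        obtain ⟨hL, hR⟩ := BoxOK_splitT C hT1 hat hg htabs hB htm
        have cL := ih _ _ _ hL h1
        have cR := ih _ _ _ hR h
        intro u θ hp T hTa hTb
        obtain ⟨hu1, hu2, hθ1, hθ2, hθπ⟩ := hp
        rcases le_total θ ((((B.T1.t + B.T2.t) / 2 : ℚ)) : ℝ) with hc | hc
        · exact cL u θ ⟨hu1, hu2, hθ1, hc, hθπ⟩ T hTa hTb
        · exact cR u θ ⟨hu1, hu2, hc, hθ2, hθπ⟩ T hTa hTb
      · simp at h

/-- **The sub-boxes of the root partition are valid.** [folklore] -/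
theorem subBox_ok (hT1 : 0 < C.T1) (hat : atomsOK C C.atoms = true) (hg : gridOK C = true)
    {tabs : List (List TabE)} (htabs : List.Forall₂ (TabOK C) C.atoms tabs) (KU KT k l : ℕ) :
    BoxOK C tabs (subBox C tabs KU KT k l) := by
  have ht1 : 0 ≤ piHi * (l : ℚ) / (KT : ℚ) := by unfold piHi; positivity
  have ht2 : 0 ≤ piHi * ((l : ℚ) + 1) / (KT : ℚ) := by unfold piHi; positivity
  have hU1 := mkUD_ok C hat (C.uMin + (C.uMax - C.uMin) * (k : ℚ) / (KU : ℚ))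
  have hU2 := mkUD_ok C hat (C.uMin + (C.uMax - C.uMin) * ((k : ℚ) + 1) / (KU : ℚ))
  have hT1' := mkTD_ok C hat hg htabs ht1
  have hT2' := mkTD_ok C hat hg htabs ht2
  exact ⟨hU1, hU2, hT1', hT2', fun T h1 h2 => eCorner_spec C hT1 hU1 hT1' h1 h2,
    fun T h1 h2 => eCorner_spec C hT1 hU1 hT2' h1 h2, fun T h1 h2 => eCorner_spec C hT1 hU2 hT1' h1 h2,
    fun T h1 h2 => eCorner_spec C hT1 hU2 hT2' h1 h2, rfl⟩

end KCert

/-- Registered sub-goal marker `stub_certMid_part15` of crux stmt-SmoothPoincare4-7631 (helper file 9-b of the kernel-clean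
`stub_certMid`, line killing-flux): splitting a valid box in `u` keeps both halves valid. [folklore] -/
theorem stub_certMid_part15 : ∀ (C : KCert.KCell), 0 < C.T1 → KCert.atomsOK C C.atoms = true →
    ∀ (tabs : List (List KCert.TabE)) (B : KCert.BoxD) (um : ℚ), KCert.BoxOK C tabs B →
      KCert.BoxOK C tabs ⟨B.U1, KCert.mkUD C um, B.T1, B.T2, B.e11, B.e12, KCert.eCorner C (KCert.mkUD C um) B.T1,
        KCert.eCorner C (KCert.mkUD C um) B.T2⟩ :=
  fun C h1 h2 _ _ um hB => (KCert.BoxOK_splitU C h1 h2 hB um).1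

end Summit.SmoothPoincare4.SmoothPoincare4.Cruxes.CylinderRungTwo.KillingFlux

end
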